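import Summits.QuantumAdvantage.QuantumAdvantage.Theorems.CubicForrelationNearExactIsExactSixteenSplitPrep
import Summits.QuantumAdvantage.QuantumAdvantage.Theorems.CubicForrelationNearExactIsExactSixteenSplitBudget

/-!
# Crux `CubicForrelation.NearExactIsExact` (stmt-QuantumAdvantage-14043) — n = 16, TWO-SIDED: the split configuration (sC) is not realizable

Certificate seat `b2b-cforr-cert` (gen 6).  HONEST FRAMING: a theorem about cubic Boolean pairs on 16 bits (finite slice `n = 16` of the crux) —
one of the three split boundary configurations of `Φ = 31/32` (`sb_split_trichotomy`) is excluded; NOT summit progress.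

Configuration (sC): `W_g = 64u`, the parity `d₀ = [u odd]` is a non-constant affine function (`L = {u odd}`, `H` its complement, `2¹⁵` points
each), the digit sets `A = B = ∅` and `C = {u odd, d₁ = d₂}` has `2¹²` points; the residual `τ = u − 4(−1)^f` is `0` on `H`, `(−1)^{d₁}` on
`L ∖ C` and `−3(−1)^{d₁}` on `C` (`d₁ = [⌊u/2⌋ odd]`, quadratic).  So `τ = (−1)^{d₁}·1_L − 4·(−1)^{d₁}·1_C`.
* `C` is the support of the degree-`≤ 4` function `¬(d₁ ⊕ d₂)` with `2¹²` ones: a 12-flat `x_C ⊕ V_C` (`mw_flat_of_minweight`); `L` is the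
  15-flat of periods `V_L` of `d₀`; `V_C ⊆ V_L` (affine `d₀`, `C ⊂ L`).
* `d₁ ≡ 0` on `H` (`A = ∅`), so every derivative `D_a d₁`, `a ∈ V_L`, vanishes on `H` and is constant on `L` (`sp_affine_const_on_L`): all of
  `V_L` (resp. `V_C`) are periods up to sign of `(−1)^{d₁}1_L` (resp. `(−1)^{d₁}1_C`), and `fp_l1_sq_mul_le` gives `Σ|·̂| ≤ 2¹⁶` for both.
* Pairing (`sl_pairing16`): `2²¹ = Σ_y (−1)^g τ̂(y) ≤ 2¹⁶ + 4·2¹⁶`. Contradiction (`sc_splitC_false`).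

References: J. Ax (1964) / R. J. McEliece (1972); MacWilliams–Sloane (1977) Ch. 13–15; R. O'Donnell (2014) §3.3.  Everything below is proved
from Mathlib and the tree; axioms are the standard three.
-/

set_option linter.dupNamespace false -- D-0017: single-problem summit ⇒ `QuantumAdvantage.QuantumAdvantage` by design

noncomputable section

namespace Summit.QuantumAdvantage.QuantumAdvantage.Theorems.CubicForrelation.NearExactIsExact

open Finset
open Literature.Computability.QuantumComplexity
open Literature.Computability.QuantumComplexity.BuzetChailloux (bxor zeroVec bxor_bxor_cancel_left bxor_zeroVec zeroVec_bxor bxor_comm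
  bxor_self)
open Literature.Computability.QuantumComplexity.DerivativeWalsh (W)

/-- **Configuration (sC) is empty.**  For cubic `f, g : 𝔽₂¹⁶ → 𝔽₂` with `W_g = 64u`, a non-constant parity `[u odd]`, `Φ(f,g) = 31/32`, the
pointwise budget identity of `sb_split_trichotomy`, and digit sets `A = B = ∅`, `#C = 2¹²`: contradiction. [this work] -/
theorem sc_splitC_false (f g : (Fin (8 + 8) → Bool) → Bool) (hf : IsDegLeFun 3 f) (hg : IsDegLeFun 3 g)
    (u : (Fin (8 + 8) → Bool) → ℤ) (hu : ∀ x, W (fun y => signOf (g y)) x = (2 : ℝ) ^ 6 * (u x : ℝ))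
    (hodd : ∃ x, Odd (u x)) (heven : ∃ x, ¬ Odd (u x)) (hΦ : forrelation f g = 31 / 32)
    (hpt : ∀ x, (u x - 4 * sZ (f x)) ^ 2 = (if Odd (u x) then 1 else 0) + 4 * (if ¬ Odd (u x) ∧ Odd (u x / 2) then 1 else 0)
      + 16 * (if ¬ Odd (u x) ∧ ¬ Odd (u x / 2) ∧ ¬ Odd (u x / 2 / 2) then 1 else 0)
      + 8 * (if Odd (u x) ∧ (Odd (u x / 2) ↔ Odd (u x / 2 / 2)) then 1 else 0))
    (hA0 : #(univ.filter fun x : Fin (8 + 8) → Bool => ¬ Odd (u x) ∧ Odd (u x / 2)) = 0)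
    (hB0 : #(univ.filter fun x : Fin (8 + 8) → Bool => ¬ Odd (u x) ∧ ¬ Odd (u x / 2) ∧ ¬ Odd (u x / 2 / 2)) = 0)
    (hCc : #(univ.filter fun x : Fin (8 + 8) → Bool => Odd (u x) ∧ (Odd (u x / 2) ↔ Odd (u x / 2 / 2))) = 2 ^ 12) : False := by
  classical
  have _hf := hf
  -- digits
  have hd0 : IsDegLeFun 1 (fun x => decide (Odd (u x))) := sx_digitZero g u hg hu
  have hd1 : IsDegLeFun 2 (fun x => decide (Odd (u x / 2))) := sx_digitOne g u hg hu
  have hd2 : IsDegLeFun 4 (fun x => decide (Odd (u x / 2 / 2))) := sx_digitTwo g u hg hu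
  have hA : ∀ x, ¬ Odd (u x) → ¬ Odd (u x / 2) := by
    intro x hx h2
    have := filter_eq_empty_iff.1 (card_eq_zero.1 hA0) (mem_univ x)
    exact this ⟨hx, h2⟩
  have hB : ∀ x, ¬ Odd (u x) → Odd (u x / 2 / 2) := by
    intro x hx
    by_contra h3
    have := filter_eq_empty_iff.1 (card_eq_zero.1 hB0) (mem_univ x)
    exact this ⟨hx, hA x hx, h3⟩
  set C := univ.filter (fun x : Fin (8 + 8) → Bool => Odd (u x) ∧ (Odd (u x / 2) ↔ Odd (u x / 2 / 2))) with hCdef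
  have hmemC : ∀ x, x ∈ C ↔ Odd (u x) ∧ (Odd (u x / 2) ↔ Odd (u x / 2 / 2)) := fun x => by simp [hCdef]
  -- the residual
  have hτH : ∀ x, ¬ Odd (u x) → u x - 4 * sZ (f x) = 0 := by
    intro x hx
    have h := hpt x
    rw [if_neg hx, if_neg (fun h => hA x hx h.2), if_neg (fun h => h.2.2 (hB x hx)), if_neg (fun h => hx h.1)] at h
    have h' : (u x - 4 * sZ (f x)) ^ 2 = 0 := by linarith
    exact (pow_eq_zero_iff two_ne_zero).1 h'
  have hτL : ∀ x, Odd (u x) → x ∉ C → u x - 4 * sZ (f x) = sZ (decide (Odd (u x / 2))) := by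
    intro x hx hxC
    have h := hpt x
    rw [if_pos hx, if_neg (fun h => h.1 hx), if_neg (fun h => h.1 hx), if_neg (fun h => hxC ((hmemC x).2 h))] at h
    have h1 : (u x - 4 * sZ (f x)) * (u x - 4 * sZ (f x)) = 1 := by rw [← pow_two]; linarith
    exact sp_tau_one (mul_self_eq_one_iff.1 h1)
  have hτC : ∀ x, x ∈ C → u x - 4 * sZ (f x) = -3 * sZ (decide (Odd (u x / 2))) := by
    intro x hxC
    have hx := ((hmemC x).1 hxC).1
    have h := hpt x
    rw [if_pos hx, if_neg (fun h => h.1 hx), if_neg (fun h => h.1 hx), if_pos ((hmemC x).1 hxC)] at h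
    exact sp_tau_three (by linarith)
  -- `C` is a 12-flat
  have hdegC : IsDegLeFun (3 + 1) (fun x => (decide (Odd (u x / 2)) ^^ decide (Odd (u x / 2 / 2))) ^^ true) :=
    tb_isDegLeFun_xor_const (bb_isDegLeFun_bxor (hd1.mono (by norm_num)) hd2) true
  have hsetC : (univ.filter fun x : Fin (8 + 8) → Bool =>
      ((decide (Odd (u x / 2)) ^^ decide (Odd (u x / 2 / 2))) ^^ true) = true) = C := by
    rw [hCdef]
    apply filter_congr
    intro x _
    by_cases h0 : Odd (u x)
    · by_cases h1 : Odd (u x / 2) <;> by_cases h2 : Odd (u x / 2 / 2) <;> simp [h0, h1, h2]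
    · simp [h0, hA x h0, hB x h0]
  have hmwC := mw_flat_of_minweight 3 _ hdegC (by rw [hsetC, hCc]; norm_num)
  rw [hsetC] at hmwC
  obtain ⟨h0C, haddC, hcardVC, hcosetC⟩ := hmwC
  set VC := univ.filter (fun a : Fin (8 + 8) → Bool => ∀ x,
    ((decide (Odd (u (bxor x a) / 2)) ^^ decide (Odd (u (bxor x a) / 2 / 2))) ^^ true) =
      ((decide (Odd (u x / 2)) ^^ decide (Odd (u x / 2 / 2))) ^^ true)) with hVC
  obtain ⟨xC, hxC⟩ : C.Nonempty := by rw [← card_pos, hCc]; norm_num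
  have hSC : C = VC.image (bxor xC) := hcosetC xC (by
    have h := (hmemC xC).1 hxC
    by_cases h1 : Odd (u xC / 2)
    · have h2 : Odd (u xC / 2 / 2) := h.2.1 h1
      simp [h1, h2]
    · have h2 : ¬ Odd (u xC / 2 / 2) := fun h' => h1 (h.2.2 h')
      simp [h1, h2])
  -- `L` is the 15-flat of periods of `d₀`
  have hfiltL : (univ.filter fun x : Fin (8 + 8) → Bool => decide (Odd (u x)) = true) = univ.filter fun x => Odd (u x) :=
    filter_congr fun x _ => by simp
  have hL15 : #(univ.filter fun x : Fin (8 + 8) → Bool => Odd (u x)) = 2 ^ 15 := sx_card_odd_of_split g u hg hu hodd heven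
  have hd0' : IsDegLeFun (0 + 1) (fun x => decide (Odd (u x))) := hd0
  have hmwL := mw_flat_of_minweight 0 _ hd0' (by rw [hfiltL, hL15]; norm_num)
  obtain ⟨h0L, haddL, hcardVL, -⟩ := hmwL
  rw [hfiltL, hL15] at hcardVL
  set VL := univ.filter (fun a : Fin (8 + 8) → Bool => ∀ x, decide (Odd (u (bxor x a))) = decide (Odd (u x))) with hVL
  have hperL : ∀ a ∈ VL, ∀ x, decide (Odd (u (bxor x a))) = decide (Odd (u x)) := fun a ha => (mem_filter.1 ha).2
  -- `V_C ⊆ V_L` (affine `d₀`, `C ⊂ L`)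
  have hVCL : ∀ a ∈ VC, ∀ x, decide (Odd (u (bxor x a))) = decide (Odd (u x)) := by
    intro a ha x
    have hxa : bxor xC a ∈ C := fl1_coset_vadd haddC hSC hxC ha
    have hc := tc_const_of_deg_zero (stub_derivDegree (8 + 8) 0 (fun x => decide (Odd (u x))) a hd0) x xC
    have e1 : decide (Odd (u xC)) = true := decide_eq_true ((hmemC xC).1 hxC).1
    have e2 : decide (Odd (u (bxor xC a))) = true := decide_eq_true ((hmemC _).1 hxa).1
    simp only [e1, e2] at hc
    revert hc; cases decide (Odd (u (bxor x a))) <;> cases decide (Odd (u x)) <;> decide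
  -- `d₁ ≡ 0` on `H`, so its derivatives along periods of `d₀` vanish on `H`
  have hqH : ∀ a : Fin (8 + 8) → Bool, (∀ x, decide (Odd (u (bxor x a))) = decide (Odd (u x))) →
      ∀ h, decide (Odd (u h)) = false → decide (Odd (u (bxor h a) / 2)) = decide (Odd (u h / 2)) := by
    intro a ha h hh
    have hh' : ¬ Odd (u h) := by simpa using hh
    have hha : ¬ Odd (u (bxor h a)) := by have := ha h; rw [hh] at this; simpa using this
    rw [decide_eq_false (hA h hh'), decide_eq_false (hA _ hha)]
  obtain ⟨xH, hxH⟩ := heven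
  have hxH' : decide (Odd (u xH)) = false := decide_eq_false hxH
  -- the two pieces of the residual
  set AL : (Fin (8 + 8) → Bool) → ℝ := fun x => if decide (Odd (u x)) = true then signOf (decide (Odd (u x / 2))) else 0 with hAL
  set AC : (Fin (8 + 8) → Bool) → ℝ := fun x => if x ∈ C then signOf (decide (Odd (u x / 2))) else 0 with hAC
  have hdecomp : (fun x => (u x : ℝ) - 4 * signOf (f x)) = fun x => AL x + (-4) * AC x := by
    funext x
    have e : (u x : ℝ) - 4 * signOf (f x) = (((u x - 4 * sZ (f x) : ℤ)) : ℝ) := by push_cast; rw [tp_sZ_cast]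
    rw [e]
    by_cases hx : Odd (u x)
    · by_cases hxC' : x ∈ C
      · simp only [AL, AC, if_pos (decide_eq_true hx), if_pos hxC']
        rw [hτC x hxC']; push_cast; rw [tp_sZ_cast]; ring
      · simp only [AL, AC, if_pos (decide_eq_true hx), if_neg hxC']
        rw [hτL x hx hxC']; rw [tp_sZ_cast]; ring
    · have hxC' : x ∉ C := fun h => hx ((hmemC x).1 h).1
      have hdx : ¬ decide (Odd (u x)) = true := by simpa using hx
      simp only [AL, AC, if_neg hdx, if_neg hxC']
      rw [hτH x hx]; norm_num
  -- `L¹` bound for the `L`-piece: `(Σ|Â_L|)²·2¹⁵ ≤ 2³²·2¹⁵`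
  have hL := sp_L_l1 (fun x => decide (Odd (u x))) (fun x => decide (Odd (u x / 2))) hd0 hd1 VL h0L haddL hperL
    (fun a ha => hqH a (hperL a ha)) hxH'
  rw [hcardVL, hfiltL, hL15] at hL
  have hXle : ∑ y, |W AL y| ≤ 2 ^ 16 := by
    have hnn : 0 ≤ ∑ y, |W AL y| := sum_nonneg fun y _ => abs_nonneg _
    push_cast at hL
    nlinarith
  -- `L¹` bound for the `C`-piece: periods up to sign along `V_C`
  have hperC : ∀ a ∈ VC, ∃ c : ℝ, (c = 1 ∨ c = -1) ∧ ∀ x, AC (bxor x a) = c * AC x := by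
    intro a ha
    have hDq : IsDegLeFun 1 (fun y => decide (Odd (u y / 2)) ^^ decide (Odd (u (bxor y a) / 2))) :=
      stub_derivDegree (8 + 8) 1 (fun x => decide (Odd (u x / 2))) a hd1
    have hDqH : ∀ h, decide (Odd (u h)) = false → (decide (Odd (u h / 2)) ^^ decide (Odd (u (bxor h a) / 2))) = false := by
      intro h hh; rw [hqH a (hVCL a ha) h hh]; cases decide (Odd (u h / 2)) <;> rfl
    refine ⟨signOf (decide (Odd (u xC / 2)) ^^ decide (Odd (u (bxor xC a) / 2))), ?_, fun x => ?_⟩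
    · unfold signOf; split_ifs <;> simp
    · by_cases hx : x ∈ C
      · have hxa : bxor x a ∈ C := fl1_coset_vadd haddC hSC hx ha
        simp only [AC, if_pos hx, if_pos hxa]
        have hc := sp_affine_const_on_L _ (fun x => decide (Odd (u x))) hDq hd0 hDqH hxH'
          (decide_eq_true ((hmemC x).1 hx).1) (decide_eq_true ((hmemC xC).1 hxC).1)
        have hqa : decide (Odd (u (bxor x a) / 2)) =
            (decide (Odd (u x / 2)) ^^ (decide (Odd (u xC / 2)) ^^ decide (Odd (u (bxor xC a) / 2)))) := by
          rw [← hc]; cases decide (Odd (u x / 2)) <;> cases decide (Odd (u (bxor x a) / 2)) <;> rfl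
        rw [hqa, signOf_xor]; ring
      · have hxa : bxor x a ∉ C := fl1_coset_out' haddC hSC hx ha
        simp only [AC, if_neg hx, if_neg hxa, mul_zero]
  have hCb := fp_l1_sq_mul_le AC C VC (fun x hx => by
      simp only [AC, if_pos hx]; unfold signOf; split_ifs <;> simp) (fun x hx => by simp only [AC, if_neg hx]) h0C haddC hperC
  rw [hcardVC, hCc] at hCb
  have hYle : ∑ y, |W AC y| ≤ 2 ^ 16 := by
    have hnn : 0 ≤ ∑ y, |W AC y| := sum_nonneg fun y _ => abs_nonneg _
    push_cast at hCb
    nlinarith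
  -- the pairing identity needs `2²¹`
  have hpair := sl_pairing16 f g u hu
  rw [hΦ, hdecomp] at hpair
  have e2 : ∀ y, signOf (g y) * W (fun x => AL x + (-4) * AC x) y =
      signOf (g y) * W AL y + (-4) * (signOf (g y) * W AC y) := fun y => by
    rw [sp_W_add, fl1_W_smul]; ring
  rw [sum_congr rfl fun y _ => e2 y, sum_add_distrib, ← mul_sum] at hpair
  have hPL : ∑ y, signOf (g y) * W AL y ≤ ∑ y, |W AL y| := fl1_pairing_le_l1 g (W AL)
  have hPC : |∑ y, signOf (g y) * W AC y| ≤ ∑ y, |W AC y| :=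
    (abs_sum_le_sum_abs _ _).trans (sum_le_sum fun y _ => by
      rw [abs_mul]; unfold signOf; split_ifs <;> norm_num)
  have hPC' := (abs_le.1 hPC).1
  have h26 : (2 : ℝ) ^ 26 * (1 - 31 / 32) = 2 ^ 21 := by norm_num
  rw [h26] at hpair
  linarith

end Summit.QuantumAdvantage.QuantumAdvantage.Theorems.CubicForrelation.NearExactIsExact

end
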